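import Mathlib
import HarnessLib
import Summits.Ventures.LatticeQCDFlow.Scaling.AutoregressiveProposalSlowingDown
import Summits.Ventures.LatticeQCDFlow.Scaling.AutoregressiveGaugeKLExtensive

/-!
# LatticeQCDFlow / Scaling — EXPONENTIAL SLOWING DOWN IN THE NUMBER OF BLIND LINKS: an exact sampler
# driven by an autoregressive proposal pays `τ_int(sign) ≥ e^{KL} − ½ ≥ exp(½ Σ_k δ_k²) − ½` and keeps a
# Kish fraction `≤ e^{−KL}`; for Wilson lattice gauge theory with `m` links generated after their staples
# from endpoint-blind conditionals, `τ_int ≥ exp(m f(r)²/2) − ½` at every volume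

HONEST FRAMING: exact (Metropolis-corrected) sampling algorithms for lattice gauge theory;
figures of merit are autocorrelation/cost numbers at stated couplings and volumes; no
continuum-physics claim.

Venture `LatticeQCDFlow` (cell pub-lqcd), topic `Scaling`, FANOUT row 30 (lean-1, GEN-20) — OUR WORK on
THEORY-2.md §4 row C5: the bridge from the cell's autoregressive context bounds to the venture's two
figures of merit, for Wilson lattice gauge theory.  Assembled from `Scaling/AutoregressiveProposalSlowingDown`
(general product spaces: `exp(KL) ≤ 1/κ`, `exp(KL) − ½ ≤ τ_int(sign)` for the autoregressive hybrid, over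
row 2's `Exactness/FlowSamplerKLFloor`) and `Scaling/AutoregressiveGaugeKLExtensive` (`KL ≥ |S| f(r)²/2` for
`|S|` witnessed links).  So far the cell's autoregressive files
controlled the ACCEPTANCE (`1 − ⟨W⟩/4` per blind link — not extensive) and the LOSS; here the integrated
autocorrelation time and the effective sample size, EXPONENTIALLY in the number of blind links.

## What is proved (all [ours]; assembled)

* (Wilson weight on `(ℤ/L)^d`, `L ≥ 2`, unitary continuous `ρ` with a central scalar `ω ≠ 1`,
  `|ω| = 1`, `N ≥ 1`, `d ≥ 2`, `β > 0`; a sub-list `S` of witnessed steps as in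
  `Scaling/AutoregressiveGaugeKLExtensive`; any `r > 0` with `f(r) = 1 − 8r²/N + 2 log φ_ρ(r)/((d−1)Nβ) ≥ 0`):
  **`wilson_arHybrid_invKish_ge_exp`** — `exp(|S| f(r)²/2) ≤ 1/κ`;
  **`wilson_arHybrid_tauInt_sign_ge_exp`** — `exp(|S| f(r)²/2) − ½ ≤ τ_int(g)` for every balanced sign
  observable `g` of the exact sampler.

READING (value-free): an exact flow / autoregressive sampler for SU(n), U(N) or U(1) lattice gauge theory
in any dimension whose proposal generates `m` links after their staples from conditionals that ignore
the links at one endpoint needs at least `exp(m f(r)²/2) − ½` sampler steps per independent sign of ANY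
balanced sign observable, and its reweighting estimator retains at most the fraction `exp(−m f(r)²/2)`
of the sample — at every volume, `f(r) → 1` as `β → ∞`; `m` grows like the volume for any architecture
that is blind in a translation-invariant way (`m ≥ L^d/3` in EVERY order of all links for a model blind at
every link: `Scaling/AutoregressiveGaugeKLExtensiveAnyOrder`).  NOT CLAIMED: smooth observables; the
acceptance itself (capped only by `1 − ⟨W⟩/4`); the reverse relative entropy.
No `def`, no `sorry`, nothing cited as a fact beyond the tree.
-/

noncomputable section

namespace Summit.Ventures.LatticeQCDFlow.Theory2.Autoregressive

open MeasureTheory Function Set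
open Summit.Ventures.LatticeQCDFlow.Exactness Summit.Ventures.LatticeQCDFlow.Scoring

/-! ## Wilson lattice gauge theory: exponential in the number of witnessed blind links -/

section Wilson

open Literature.MathematicalPhysics.QuantumFieldTheory Literature.MathematicalPhysics.QuantumLattice
open scoped Matrix Matrix.Norms.Frobenius

variable {d L N : ℕ} {G : Type*} [Group G] [TopologicalSpace G] [IsTopologicalGroup G]
  [CompactSpace G] [SecondCountableTopology G] [MeasurableSpace G] [BorelSpace G] [NeZero L]
  (ρ : G →* Matrix (Fin N) (Fin N) ℂ)

/-- **`1/κ ≥ exp(|S|·f(r)²/2)`** — the inverse Kish fraction of the importance weights `e^{−βS_W}/H_l` of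
an autoregressive model with `|S|` witnessed endpoint-blind links is exponentially large in `|S|`,
uniformly in the volume (hypotheses as in `wilson_kl_arHybrid_ge_card_mul_linkBall_sq`). [ours] -/
theorem wilson_arHybrid_invKish_ge_exp [NeZero N] (hd : 2 ≤ d) (hN : 1 ≤ N) (hρ : Continuous ρ)
    (hρU : ∀ g, ρ g ∈ Matrix.unitaryGroup (Fin N) ℂ) (hL : 2 ≤ L)
    {z : G} {ω : ℂ} (hω : ρ z = ω • (1 : Matrix (Fin N) (Fin N) ℂ)) (hω1 : ‖ω‖ = 1) (hne : ω ≠ 1)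
    {β : ℝ} (hβ : 0 < β) {r : ℝ} (hr : 0 < r)
    (hf : 0 ≤ 1 - 8 * r ^ 2 / N +
      2 * Real.log ((haarProbability G).real {g : G | ‖ρ g - 1‖ ≤ r}) / (((d : ℝ) - 1) * N * β))
    {q : Edge d L → GaugeConfig d L G → ℝ} (hqm : ∀ a, Measurable (q a)) {cq Cq : ℝ} (hcq : 0 < cq)
    (hqlo : ∀ a U, cq ≤ q a U) (hqhi : ∀ a U, q a U ≤ Cq)
    (hq1 : ∀ a U, ∫ v, q a (update U a v) ∂(haarProbability G) = 1)
    (l : List (Edge d L)) (hl : l.Nodup)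
    (hpw : l.Pairwise (fun a b => ∀ (U : GaugeConfig d L G) (v : G), q a (update U b v) = q a U))
    (S : List (Edge d L × List (Edge d L))) (hS : S.Sublist (l.zip l.tails.tail))
    (P : Edge d L × List (Edge d L) → Plaquette d L) (Y : Edge d L × List (Edge d L) → Site d L)
    (hP : ∀ c ∈ S, c.1 ∈ ({((P c).1, (P c).2.1.1), ((P c).1.shift (P c).2.1.1, (P c).2.1.2),
        ((P c).1.shift (P c).2.1.2, (P c).2.1.1), ((P c).1, (P c).2.1.2)} : Finset (Edge d L)))
    (hPs : ∀ c ∈ S, c.2.toFinset ⊆ Finset.univ \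
      {((P c).1, (P c).2.1.1), ((P c).1.shift (P c).2.1.1, (P c).2.1.2),
        ((P c).1.shift (P c).2.1.2, (P c).2.1.1), ((P c).1, (P c).2.1.2)})
    (hY : ∀ c ∈ S, c.1.1 = Y c ∨ c.1.1.shift c.1.2 = Y c)
    (hqB : ∀ c ∈ S, ∀ e : Edge d L, e.1 = Y c ∨ e.1.shift e.2 = Y c → e ≠ c.1 →
      ∀ (U : GaugeConfig d L G) (v : G), q c.1 (update U e v) = q c.1 U) :
    Real.exp ((S.length : ℝ) * (1 - 8 * r ^ 2 / N +
        2 * Real.log ((haarProbability G).real {g : G | ‖ρ g - 1‖ ≤ r}) / (((d : ℝ) - 1) * N * β)) ^ 2 / 2) ≤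
      (∫ U, Real.exp (-β * wilsonAction ρ U) /
            ((l.map fun b => q b U).prod *
                coordAvg (haarProbability G) l.toFinset
                  (fun V : GaugeConfig d L G => Real.exp (-β * wilsonAction ρ V)) U /
              ∫ W, Real.exp (-β * wilsonAction ρ W) ∂Measure.pi (fun _ : Edge d L => haarProbability G)) *
          Real.exp (-β * wilsonAction ρ U) ∂Measure.pi (fun _ : Edge d L => haarProbability G)) /
        (∫ W, Real.exp (-β * wilsonAction ρ W) ∂Measure.pi (fun _ : Edge d L => haarProbability G)) ^ 2 := by
  obtain ⟨hFm, B, hFlo, hFhi⟩ := wilsonWeight_props (d := d) (L := L) ρ hρ β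
  have hkl := wilson_kl_arHybrid_ge_card_mul_linkBall_sq (d := d) (L := L) ρ hd hN hρ hρU hL hω hω1 hne hβ
    hr hf hqm hcq hqlo hqhi hq1 l hl hpw S hS P Y hP hPs hY hqB
  exact (Real.exp_le_exp.2 hkl).trans (arHybrid_exp_kl_le_invKish (haarProbability G) hqm hcq hqlo hqhi
    hq1 hFm (Real.exp_pos _) hFlo hFhi l hpw)

/-- **THE EXPONENTIAL SLOWING DOWN: `τ_int(g) ≥ exp(|S|·f(r)²/2) − ½`** for every measurable balanced sign
observable `g` (`g² = 1`, `∫ g e^{−βS_W} dπ = 0`) of the exact independence sampler with target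
`e^{−βS_W}/Z` and an autoregressive proposal `H_l` having `|S|` witnessed endpoint-blind links
(hypotheses as in `wilson_kl_arHybrid_ge_card_mul_linkBall_sq`) — at every volume. [ours] -/
theorem wilson_arHybrid_tauInt_sign_ge_exp [NeZero N] (hd : 2 ≤ d) (hN : 1 ≤ N) (hρ : Continuous ρ)
    (hρU : ∀ g, ρ g ∈ Matrix.unitaryGroup (Fin N) ℂ) (hL : 2 ≤ L)
    {z : G} {ω : ℂ} (hω : ρ z = ω • (1 : Matrix (Fin N) (Fin N) ℂ)) (hω1 : ‖ω‖ = 1) (hne : ω ≠ 1)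
    {β : ℝ} (hβ : 0 < β) {r : ℝ} (hr : 0 < r)
    (hf : 0 ≤ 1 - 8 * r ^ 2 / N +
      2 * Real.log ((haarProbability G).real {g : G | ‖ρ g - 1‖ ≤ r}) / (((d : ℝ) - 1) * N * β))
    {q : Edge d L → GaugeConfig d L G → ℝ} (hqm : ∀ a, Measurable (q a)) {cq Cq : ℝ} (hcq : 0 < cq)
    (hqlo : ∀ a U, cq ≤ q a U) (hqhi : ∀ a U, q a U ≤ Cq)
    (hq1 : ∀ a U, ∫ v, q a (update U a v) ∂(haarProbability G) = 1)
    (l : List (Edge d L)) (hl : l.Nodup)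
    (hpw : l.Pairwise (fun a b => ∀ (U : GaugeConfig d L G) (v : G), q a (update U b v) = q a U))
    (S : List (Edge d L × List (Edge d L))) (hS : S.Sublist (l.zip l.tails.tail))
    (P : Edge d L × List (Edge d L) → Plaquette d L) (Y : Edge d L × List (Edge d L) → Site d L)
    (hP : ∀ c ∈ S, c.1 ∈ ({((P c).1, (P c).2.1.1), ((P c).1.shift (P c).2.1.1, (P c).2.1.2),
        ((P c).1.shift (P c).2.1.2, (P c).2.1.1), ((P c).1, (P c).2.1.2)} : Finset (Edge d L)))
    (hPs : ∀ c ∈ S, c.2.toFinset ⊆ Finset.univ \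
      {((P c).1, (P c).2.1.1), ((P c).1.shift (P c).2.1.1, (P c).2.1.2),
        ((P c).1.shift (P c).2.1.2, (P c).2.1.1), ((P c).1, (P c).2.1.2)})
    (hY : ∀ c ∈ S, c.1.1 = Y c ∨ c.1.1.shift c.1.2 = Y c)
    (hqB : ∀ c ∈ S, ∀ e : Edge d L, e.1 = Y c ∨ e.1.shift e.2 = Y c → e ≠ c.1 →
      ∀ (U : GaugeConfig d L G) (v : G), q c.1 (update U e v) = q c.1 U)
    {g : GaugeConfig d L G → ℝ} (hgm : Measurable g) (hg1 : ∀ U, g U ^ 2 = 1)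
    (hg0 : ∫ U, g U * Real.exp (-β * wilsonAction ρ U) ∂Measure.pi (fun _ : Edge d L => haarProbability G) = 0) :
    Real.exp ((S.length : ℝ) * (1 - 8 * r ^ 2 / N +
        2 * Real.log ((haarProbability G).real {g : G | ‖ρ g - 1‖ ≤ r}) / (((d : ℝ) - 1) * N * β)) ^ 2 / 2)
        - 1 / 2 ≤
      tauInt (fun k => (∫ U, g U * ((imhOp (Measure.pi fun _ : Edge d L => haarProbability G)
          (fun V : GaugeConfig d L G => Real.exp (-β * wilsonAction ρ V))
          (fun V : GaugeConfig d L G => (l.map fun b => q b V).prod *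
              coordAvg (haarProbability G) l.toFinset
                (fun V' : GaugeConfig d L G => Real.exp (-β * wilsonAction ρ V')) V /
            ∫ W, Real.exp (-β * wilsonAction ρ W) ∂Measure.pi (fun _ : Edge d L => haarProbability G)))^[k]
            g) U * Real.exp (-β * wilsonAction ρ U) ∂Measure.pi (fun _ : Edge d L => haarProbability G)) /
          ∫ U, g U ^ 2 * Real.exp (-β * wilsonAction ρ U) ∂Measure.pi (fun _ : Edge d L => haarProbability G)) := by
  obtain ⟨hFm, B, hFlo, hFhi⟩ := wilsonWeight_props (d := d) (L := L) ρ hρ β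
  have hkl := wilson_kl_arHybrid_ge_card_mul_linkBall_sq (d := d) (L := L) ρ hd hN hρ hρU hL hω hω1 hne hβ
    hr hf hqm hcq hqlo hqhi hq1 l hl hpw S hS P Y hP hPs hY hqB
  have htau := arHybrid_exp_kl_le_tauInt_sign (haarProbability G) hqm hcq hqlo hqhi hq1 hFm
    (Real.exp_pos _) hFlo hFhi l hpw hgm hg1 hg0
  exact le_trans (sub_le_sub_right (Real.exp_le_exp.2 hkl) _) htau

end Wilson

end Summit.Ventures.LatticeQCDFlow.Theory2.Autoregressive

end
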